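import Summits.SmoothPoincare4.SmoothPoincare4.Theorems.CongruenceShadowsGriffithsHandlebodyExtensionCoverDefs
import Literature.Topology.FourManifolds.RoundSolidTorusSolidTwist
import HarnessLib

/-!
# SmoothPoincare4 / CongruenceShadows — `GriffithsHandlebodyExtension` (item stmt-SmoothPoincare4-15190): lifting the boundary diffeomorphism, I — angle lifts (E2)

Support file (`--supports` stmt-SmoothPoincare4-15190) of the homothety-cover proof of the genus-one
clause (E) of Griffiths' handlebody extension theorem — *every self-diffeomorphism of the Heegaard torus
`∂V` of the round solid torus fixing the base point and acting trivially on `π₁(∂V)` extends to a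
self-diffeomorphism of `V`* (hypothesis `hE` of
`Literature.Topology.FourManifolds.RoundSolidTorusModel.diffeoExtends_of_map_ker_eq_ker_of_forall_diffeoExtends`).
See the module docstring of `…CoverDefs` for the whole line (E1–E6) and the notation
(`τ̂`, `δ_λ`, `ρ`, `χ`, `f`, `Δ^(c)`, `α`, `L`, `M`, `Ψ̂`, `ẽ_c`).

This part (E2, first half): the boundary diffeomorphism `τV` in angle coordinates (`angMap`), the universal covering
`cT : ℝ² → (ℝ/2πℤ)²`, the lift `liftT` of `angMap ∘ cT` fixing the origin, the standard loops and the monodromy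
computation relating `liftT (2π, 0)`, `liftT (0, 2π)` to the action of `τV` on `π₁`.
-/

-- the registered namespace `Summit.SmoothPoincare4.SmoothPoincare4.Theorems` repeats a component
set_option linter.dupNamespace false

noncomputable section

namespace Summit.SmoothPoincare4.SmoothPoincare4.Theorems

namespace HomothetyCover

open Set Function Metric Filter
open scoped Topology ContDiff

section Lift

open Literature.Topology.FourManifolds Literature.Topology.FourManifolds.RoundSolidTorusModel
open Complex (I)
open scoped Manifold
variable (τV : (𝓡∂ 3).boundary RoundSolidTorus ≃ₘ⟮𝓡 2, 𝓡 2⟯ (𝓡∂ 3).boundary RoundSolidTorus)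

/-- The boundary diffeomorphism read in the angle coordinates `(θ, φ) ∈ ℝ/2πℤ × ℝ/2πℤ` of `∂V`. -/
def angMap : C(AddCircle (2 * Real.pi) × AddCircle (2 * Real.pi), AddCircle (2 * Real.pi) × AddCircle (2 * Real.pi)) :=
  ⟨fun θφ => boundaryHomeomorphAddCircle (τV (boundaryHomeomorphAddCircle.symm θφ)),
    boundaryHomeomorphAddCircle.continuous.comp (τV.continuous.comp boundaryHomeomorphAddCircle.symm.continuous)⟩

/-- `angMap` in terms of the angle homeomorphism `boundaryHomeomorphAddCircle`. -/
theorem angMap_apply (θφ : AddCircle (2 * Real.pi) × AddCircle (2 * Real.pi)) :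
    angMap τV θφ = boundaryHomeomorphAddCircle (τV (boundaryHomeomorphAddCircle.symm θφ)) := rfl

/-- Pulling `angMap` back through the angle homeomorphism recovers `τV`. -/
theorem symm_angMap (θφ : AddCircle (2 * Real.pi) × AddCircle (2 * Real.pi)) :
    boundaryHomeomorphAddCircle.symm (angMap τV θφ) = τV (boundaryHomeomorphAddCircle.symm θφ) := by
  rw [angMap_apply, Homeomorph.symm_apply_apply]

variable {τV}

/-- A basepoint-preserving `τV` has `angMap (0, 0) = (0, 0)`. -/
theorem angMap_zero (hτ : τV basePt = basePt) : angMap τV (0, 0) = (0, 0) := by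
  rw [angMap_apply, show boundaryHomeomorphAddCircle.symm (0, 0) = basePt from rfl, hτ,
    boundaryHomeomorphAddCircle_basePt]

/-- `π₁`-triviality of `τ` at `basePt` is `π₁`-triviality of `angMap τ` at `(0, 0)`. -/
theorem mapOfEq_angMap (hτ : τV basePt = basePt)
    (h : ∀ γ, FundamentalGroup.mapOfEq (⟨τV, τV.continuous⟩ : C(_, _)) hτ γ = γ)
    (γ : FundamentalGroup (AddCircle (2 * Real.pi) × AddCircle (2 * Real.pi)) ((0 : AddCircle (2 * Real.pi)), (0 : AddCircle (2 * Real.pi)))) :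
    FundamentalGroup.mapOfEq (angMap τV) (angMap_zero hτ) γ = γ := by
  have h0 : boundaryHomeomorphAddCircle basePt = ((0 : AddCircle (2 * Real.pi)), (0 : AddCircle (2 * Real.pi))) :=
    boundaryHomeomorphAddCircle_basePt
  have h0' : boundaryHomeomorphAddCircle.symm ((0 : AddCircle (2 * Real.pi)), (0 : AddCircle (2 * Real.pi))) = basePt := rfl
  set E := Homeomorph.fundamentalGroupCongr boundaryHomeomorphAddCircle h0 with hE
  obtain ⟨δ, rfl⟩ := E.surjective γ
  have hcomp : angMap τV = (boundaryHomeomorphAddCircle : C(_, _)).comp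
      ((⟨τV, τV.continuous⟩ : C(_, _)).comp (boundaryHomeomorphAddCircle.symm : C(_, _))) := rfl
  have step₁ : FundamentalGroup.mapOfEq (angMap τV) (angMap_zero hτ) (E δ) =
      FundamentalGroup.mapOfEq (boundaryHomeomorphAddCircle : C(_, _)) h0
        (FundamentalGroup.mapOfEq ((⟨τV, τV.continuous⟩ : C(_, _)).comp
          (boundaryHomeomorphAddCircle.symm : C(_, _))) (show _ = basePt by
            rw [ContinuousMap.comp_apply]; exact (congrArg τV h0').trans hτ) (E δ)) := by
    rw [show FundamentalGroup.mapOfEq (angMap τV) (angMap_zero hτ) =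
      FundamentalGroup.mapOfEq ((boundaryHomeomorphAddCircle : C(_, _)).comp
        ((⟨τV, τV.continuous⟩ : C(_, _)).comp (boundaryHomeomorphAddCircle.symm : C(_, _)))) _ from rfl]
    exact FundamentalGroup.mapOfEq_comp_apply _ _ _ h0 (E δ)
  have step₂ : FundamentalGroup.mapOfEq ((⟨τV, τV.continuous⟩ : C(_, _)).comp
      (boundaryHomeomorphAddCircle.symm : C(_, _))) (show _ = basePt by
        rw [ContinuousMap.comp_apply]; exact (congrArg τV h0').trans hτ) (E δ) =
      FundamentalGroup.mapOfEq (⟨τV, τV.continuous⟩ : C(_, _)) hτ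
        (FundamentalGroup.mapOfEq (boundaryHomeomorphAddCircle.symm : C(_, _)) h0' (E δ)) :=
    FundamentalGroup.mapOfEq_comp_apply _ _ h0' hτ (E δ)
  have step₃ : FundamentalGroup.mapOfEq (boundaryHomeomorphAddCircle.symm : C(_, _)) h0' (E δ) = δ := by
    have h := E.symm_apply_apply δ
    rw [hE, Homeomorph.fundamentalGroupCongr_symm_apply] at h
    exact h
  rw [step₁, step₂, step₃, h δ]
  rfl

/-! #### The lift to the universal cover `ℝ × ℝ → ℝ/2πℤ × ℝ/2πℤ` -/

/-- The universal covering of the angle torus. -/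
def cT (x : ℝ × ℝ) : AddCircle (2 * Real.pi) × AddCircle (2 * Real.pi) := ((x.1 : AddCircle (2 * Real.pi)), (x.2 : AddCircle (2 * Real.pi)))

/-- The universal covering map `cT : ℝ² → T²` is continuous. -/
theorem continuous_cT : Continuous cT := by unfold cT; fun_prop

/-- `cT 0 = 0`. -/
theorem cT_zero : cT (0, 0) = (0, 0) := by simp [cT]

/-- `cT` is `2π`-periodic in the first variable. -/
theorem cT_add_two_pi_left (x : ℝ × ℝ) : cT (x + (2 * Real.pi, 0)) = cT x := by
  simp [cT]

/-- `cT` is `2π`-periodic in the second variable. -/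
theorem cT_add_two_pi_right (x : ℝ × ℝ) : cT (x + (0, 2 * Real.pi)) = cT x := by
  simp [cT]

/-- The covering `ℝ → ℝ/2πℤ` (Mathlib). -/
theorem isCoveringMap_angle : IsCoveringMap ((↑) : ℝ → AddCircle (2 * Real.pi)) :=
  AddCircle.isCoveringMap_coe (2 * Real.pi)

variable (τV)

/-- The first component of `angMap ∘ cT`, a continuous map `ℝ × ℝ → ℝ/2πℤ`. -/
def angFst : C(ℝ × ℝ, AddCircle (2 * Real.pi)) := ⟨fun x => (angMap τV (cT x)).1, by
  exact continuous_fst.comp ((angMap τV).continuous.comp continuous_cT)⟩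

/-- The second component of `angMap ∘ cT`. -/
def angSnd : C(ℝ × ℝ, AddCircle (2 * Real.pi)) := ⟨fun x => (angMap τV (cT x)).2, by
  exact continuous_snd.comp ((angMap τV).continuous.comp continuous_cT)⟩

variable {τV}

/-- The first angle of `angMap ∘ cT` lifts through `ℝ → ℝ/2πℤ` to a continuous real function vanishing at the origin. -/
theorem exists_liftFst (hτ : τV basePt = basePt) :
    ∃ F : C(ℝ × ℝ, ℝ), F (0, 0) = 0 ∧ ((↑) : ℝ → AddCircle (2 * Real.pi)) ∘ F = angFst τV := by
  obtain ⟨F, hF, -⟩ := isCoveringMap_angle.existsUnique_continuousMap_lifts (angFst τV) (0, 0) 0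
    (by show ((0 : ℝ) : AddCircle (2 * Real.pi)) = (angMap τV (cT (0, 0))).1; rw [cT_zero, angMap_zero hτ]; simp)
  exact ⟨F, hF⟩

/-- The second angle of `angMap ∘ cT` lifts through `ℝ → ℝ/2πℤ` to a continuous real function vanishing at the origin. -/
theorem exists_liftSnd (hτ : τV basePt = basePt) :
    ∃ F : C(ℝ × ℝ, ℝ), F (0, 0) = 0 ∧ ((↑) : ℝ → AddCircle (2 * Real.pi)) ∘ F = angSnd τV := by
  obtain ⟨F, hF, -⟩ := isCoveringMap_angle.existsUnique_continuousMap_lifts (angSnd τV) (0, 0) 0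
    (by show ((0 : ℝ) : AddCircle (2 * Real.pi)) = (angMap τV (cT (0, 0))).2; rw [cT_zero, angMap_zero hτ]; simp)
  exact ⟨F, hF⟩

/-- **The lift** `F̃ : ℝ × ℝ → ℝ × ℝ` of `angMap τ` through `cT`, fixing the origin. -/
def liftT (hτ : τV basePt = basePt) (x : ℝ × ℝ) : ℝ × ℝ :=
  ((exists_liftFst hτ).choose x, (exists_liftSnd hτ).choose x)

/-- The lift `liftT` is continuous. -/
theorem continuous_liftT (hτ : τV basePt = basePt) : Continuous (liftT hτ) :=
  (exists_liftFst hτ).choose.continuous.prodMk (exists_liftSnd hτ).choose.continuous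

/-- The lift `liftT` fixes the origin. -/
theorem liftT_zero (hτ : τV basePt = basePt) : liftT hτ (0, 0) = (0, 0) :=
  Prod.ext (exists_liftFst hτ).choose_spec.1 (exists_liftSnd hτ).choose_spec.1

/-- The first component of `liftT` covers the first angle of `angMap ∘ cT`. -/
theorem coe_liftT_fst (hτ : τV basePt = basePt) (x : ℝ × ℝ) :
    ((liftT hτ x).1 : AddCircle (2 * Real.pi)) = (angMap τV (cT x)).1 :=
  congrFun (exists_liftFst hτ).choose_spec.2 x

/-- The second component of `liftT` covers the second angle of `angMap ∘ cT`. -/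
theorem coe_liftT_snd (hτ : τV basePt = basePt) (x : ℝ × ℝ) :
    ((liftT hτ x).2 : AddCircle (2 * Real.pi)) = (angMap τV (cT x)).2 :=
  congrFun (exists_liftSnd hτ).choose_spec.2 x

/-- `F̃` lifts `angMap τ`: `cT ∘ F̃ = angMap τ ∘ cT`. -/
theorem cT_liftT (hτ : τV basePt = basePt) (x : ℝ × ℝ) : cT (liftT hτ x) = angMap τV (cT x) :=
  Prod.ext (coe_liftT_fst hτ x) (coe_liftT_snd hτ x)

/-- **Uniqueness of lifts**: a continuous `G` with `cT ∘ G = angMap τ ∘ cT` agreeing with `F̃` at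
one point is `F̃`. -/
theorem liftT_unique (hτ : τV basePt = basePt) {G : ℝ × ℝ → ℝ × ℝ} (hG : Continuous G)
    (hlift : ∀ x, cT (G x) = angMap τV (cT x)) {x₀ : ℝ × ℝ} (h0 : G x₀ = liftT hτ x₀) :
    G = liftT hτ := by
  have h1 : (fun x => (G x).1) = fun x => (liftT hτ x).1 := by
    refine isCoveringMap_angle.eq_of_comp_eq (continuous_fst.comp hG)
      (continuous_fst.comp (continuous_liftT hτ)) ?_ x₀ (congrArg Prod.fst h0)
    funext x
    show ((G x).1 : AddCircle (2 * Real.pi)) = ((liftT hτ x).1 : AddCircle (2 * Real.pi))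
    rw [coe_liftT_fst, ← hlift x]; rfl
  have h2 : (fun x => (G x).2) = fun x => (liftT hτ x).2 := by
    refine isCoveringMap_angle.eq_of_comp_eq (continuous_snd.comp hG)
      (continuous_snd.comp (continuous_liftT hτ)) ?_ x₀ (congrArg Prod.snd h0)
    funext x
    show ((G x).2 : AddCircle (2 * Real.pi)) = ((liftT hτ x).2 : AddCircle (2 * Real.pi))
    rw [coe_liftT_snd, ← hlift x]; rfl
  funext x
  exact Prod.ext (congrFun h1 x) (congrFun h2 x)

/-! #### The periods of the lift: `π₁`-triviality makes `F̃` `2πℤ²`-equivariant -/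

/-- The first standard loop `s ↦ (2πs, 0)` of the angle torus at the origin. -/
def stdLoop₁ : Path ((0 : AddCircle (2 * Real.pi)), (0 : AddCircle (2 * Real.pi))) (0, 0) where
  toFun s := cT ((s : ℝ) * (2 * Real.pi), 0)
  continuous_toFun := continuous_cT.comp (by fun_prop)
  source' := by simp [cT]
  target' := by simp [cT]

/-- The second standard loop `s ↦ (0, 2πs)`. -/
def stdLoop₂ : Path ((0 : AddCircle (2 * Real.pi)), (0 : AddCircle (2 * Real.pi))) (0, 0) where
  toFun s := cT (0, (s : ℝ) * (2 * Real.pi))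
  continuous_toFun := continuous_cT.comp (by fun_prop)
  source' := by simp [cT]
  target' := by simp [cT]

/-- Formula for the first standard loop (the longitude circle through the base point). -/
theorem stdLoop₁_apply (s : unitInterval) : stdLoop₁ s = cT ((s : ℝ) * (2 * Real.pi), 0) := rfl

/-- Formula for the second standard loop (the meridian circle through the base point). -/
theorem stdLoop₂_apply (s : unitInterval) : stdLoop₂ s = cT (0, (s : ℝ) * (2 * Real.pi)) := rfl

/-- A loop at the origin is homotopic to its image under the `π₁`-trivial `angMap τ`. -/
theorem homotopic_map_angMap (hτ : τV basePt = basePt)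
    (h : ∀ γ, FundamentalGroup.mapOfEq (⟨τV, τV.continuous⟩ : C(_, _)) hτ γ = γ)
    (L : Path ((0 : AddCircle (2 * Real.pi)), (0 : AddCircle (2 * Real.pi))) (0, 0)) :
    ((L.map (angMap τV).continuous).cast (angMap_zero hτ).symm (angMap_zero hτ).symm).Homotopic L := by
  have key := mapOfEq_angMap hτ h (FundamentalGroup.fromPath (Path.Homotopic.Quotient.mk L))
  rw [FundamentalGroup.mapOfEq_apply] at key
  change ((Path.Homotopic.Quotient.mk L).map (angMap τV)).cast _ _ = Path.Homotopic.Quotient.mk L at key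
  rw [← Path.Homotopic.Quotient.mk_map, ← Path.Homotopic.Quotient.mk_cast] at key
  exact Path.Homotopic.Quotient.exact key

/-- The base point `0 ∈ ℝ` of the fibre of `ℝ → ℝ/2πℤ` over `0`. -/
def fib0 : ((↑) : ℝ → AddCircle (2 * Real.pi)) ⁻¹' {(0 : AddCircle (2 * Real.pi))} := ⟨0, by simp⟩

/-- **Monodromy computes the endpoint of a lift**: if `Λ` lifts the loop `ℓ` from `0`, the
monodromy of `ℓ` moves `0` to `Λ 1`. -/
theorem monodromy_eq_of_lift (ℓ : Path (0 : AddCircle (2 * Real.pi)) 0) {y₁ : ℝ} (Λ : Path (0 : ℝ) y₁)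
    (hΛ : ∀ s, ((Λ s : ℝ) : AddCircle (2 * Real.pi)) = ℓ s) :
    ∃ hy : y₁ ∈ ((↑) : ℝ → AddCircle (2 * Real.pi)) ⁻¹' {(0 : AddCircle (2 * Real.pi))},
      isCoveringMap_angle.monodromy (Path.Homotopic.Quotient.mk ℓ) fib0 = ⟨y₁, hy⟩ := by
  have hy : y₁ ∈ ((↑) : ℝ → AddCircle (2 * Real.pi)) ⁻¹' {(0 : AddCircle (2 * Real.pi))} := by
    rw [Set.mem_preimage, Set.mem_singleton_iff, ← Λ.target, hΛ 1, ℓ.target]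
  refine ⟨hy, ?_⟩
  refine isCoveringMap_angle.monodromy_eq_of_map_eq (ey := ⟨y₁, hy⟩)
    (Γ := Path.Homotopic.Quotient.mk Λ) ?_
  rw [← Path.Homotopic.Quotient.mk_map, ← Path.Homotopic.Quotient.mk_cast]
  congr 1
  ext s
  exact hΛ s

/-- The monodromy of the once-winding loop moves `0` to `2π`. -/
theorem monodromy_addCircleLoopZ_one :
    ((isCoveringMap_angle.monodromy
      (Path.Homotopic.Quotient.mk (addCircleLoopZ (2 * Real.pi) 1 (0 : AddCircle (2 * Real.pi)))) fib0 : ℝ)) =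
      2 * Real.pi := by
  have h := monodromy_addCircleLoopZ (p := 2 * Real.pi) 1 (0 : AddCircle (2 * Real.pi)) fib0
  rw [h]
  simp [fib0]

end Lift

end HomothetyCover

end Summit.SmoothPoincare4.SmoothPoincare4.Theorems

end
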